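import Literature.AlgebraicGeometry.Frobenioids.Cor411SubReductions
import Literature.AlgebraicGeometry.Frobenioids.DivisorMonoidCategoryTheoreticityFactsThm42iHolds
import HarnessLib

/-!
# Frobenioids I, Corollary 4.11 (i): the named fact `FrdI.Cor411iRestrict` HOLDS

Mochizuki, *The geometry of Frobenioids I: the general theory*, Kyushu J. Math. **62** (2008)
293–400, Cor. 4.11 (i) pp. 91–93 [cite: MochizukiFrdI2008, Cor. 4.11 (i) p.92]: in print's reduced case
("we may assume without loss of generality that `C₁, C₂` are of isotropic type … [and] not of group-like
type", p. 92 ll. 1–8) there is `Ψ^istr : C₁^istr ⥲ C₂^istr` over `Ψ` for which the typed Cor. 4.11 (i)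
holds.

PROOF-ONLY companion of `Cor411Sub.lean` (typer abc-iut-L1-t3 / abc-iut-L1-d6; cell fact row F-2326;
seat abc-iut-f-029): the composition `FrdI.cor411iRestrict_of_facts` (Thm. 3.4 (i), (iii), Thm. 4.2 (i))
with ALL THREE inputs now theorems of the tree — `FrdI.Thm34i_holds` (seat lineage abc-iut-L1,
`BaseCategoryTheoreticityProofs.lean`), `FrdI.Thm34iii_holds` (2008 wording of "FSMFF-type", seats
abc-iut-L1-t11 / L1-t13, `EquivalencePreStepsFSMFF2008Assembly.lean`), `FrdI.Thm42i_holds` (seat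
abc-iut-f-037, `DivisorMonoidCategoryTheoreticityFactsThm42iHolds.lean`). Nothing of [FrdI] is restated;
no new definitions; nothing here is specific to the abc programme.
-/

namespace Literature.AlgebraicGeometry.Frobenioids

universe w v v' u u'

namespace FrdI

/-- **The named fact [FrdI] Cor. 4.11 (i) for `Ψ^istr` (print's reduced case), `FrdI.Cor411iRestrict`,
HOLDS** — `cor411iRestrict_of_facts Thm34i_holds Thm34iii_holds Thm42i_holds`.
[cite: MochizukiFrdI2008, Cor. 4.11 (i) p.92] -/
theorem Cor411iRestrict_holds :
    Literature.AlgebraicGeometry.Frobenioids.FrdI.Cor411iRestrict.{w, v, v', u, u'} :=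
  cor411iRestrict_of_thm34iii_thm42i Thm34iii_holds Thm42i_holds

end FrdI

end Literature.AlgebraicGeometry.Frobenioids
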